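import Literature.NumberTheory.Irrationality.Zudilin2003.ZetaFourAnalysis
import Literature.NumberTheory.Irrationality.Zudilin2003.ZetaFourRates
import HarnessLib

/-!
# Zudilin 2003 (JTNB), §2: Lemma 3, Lemma 5 and the limit (7) of Theorem 1 — `v_n/u_n → ζ(4)`

Topic `Literature/NumberTheory/Irrationality/Zudilin2003`, sub-namespace `ZetaFour`. Source: W. Zudilin, *Well-poised
hypergeometric service for diophantine problems of zeta values*, J. Théor. Nombres Bordeaux **15** (2003) 593–626
[Zudilin2003WellPoised], §2, READ ON THE PAGE (held text `paper:galaxy-pdf-1593531969313998860`, p0004–p0007).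
This file DISCHARGES the named facts `lemma5`, `theorem1_limit` and `form_asymptotics` of `ZetaFourRecursion.lean`
(`lemma5_holds`, `theorem1_limit_holds`, `form_asymptotics_holds`), and makes Theorem 2 unconditional
(`tendsto_convergents`).

## The printed argument and how it is followed

Printed (p0005–p0007): **Lemma 2** — the certificate identity (24)
`(n+1)⁵R_{n+1}(t) − b(n)R_n(t) − 3n³(3n−1)(3n+1)R_{n−1}(t) = S_n(t+1) − S_n(t)`, `S_n = s_nR_n`
(`ZetaFourTelescoping.lean: lemma2`); **Lemma 3** — "The series (11) satisfies the difference equation (3). *Proof.*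
Since `R_n(t) = O(t^{−3})` and `S_n(t) = O(t^{−2})` … differentiating identity (24) and summing over `t = 1, 2, …`:
`(n+1)⁵F_{n+1} − b(n)F_n − 3n³(3n−1)(3n+1)F_{n−1} = S_n'(1)`. It remains to note that both functions `R_n(t)` and
`S_n(t)` have second-order zero at `t = 1`. Thus `S_n'(1) = 0` for `n ≥ 1`"; **Lemma 4/5** — `F_n = U_nζ(4) − V_n`
(after the cancellations `U_n'' = 2U_n` of Lemma 4), normalised after Lemma 5 as `u_n = U_n'/6`, `v_n = V_n/6`, the
sequences solving (3) with the data (5); and Theorem 1 (7): `lim v_n/u_n = ζ(4)`.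

Followed here: Lemma 3 exactly as printed (`deriv_identity` = the `t`-derivative of (24) on `t > 0`, obtained from
`lemma2` by uniqueness of derivatives of two functions agreeing on the open half-line; `lemma3` = the sum over
`t ≥ 1`, the right side telescoping to `lim_N S_n'(N+1) − S_n'(1) = 0 − 0` by `tendsto_Sd` and `Sd_one`). For the
growth of `S_n'` the printed `O(t^{−2})` is replaced by the cruder, sufficient `O(1/t)` (`S_n = (−1)ⁿ sNum·H_n²`,
`H_n = G_n/((t+2n−1)(t+2n))`, `|H_n| ≤ t^{−4}`, `|H_n'| ≤ (8n+7)t^{−5}`, `|sNum| ≤ Kt⁸`, `|∂_t sNum| ≤ K't⁷`).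
DEVIATION for Lemma 5: instead of the partial-fraction bookkeeping of Lemmas 1 and 4 (coefficients `A_{jk}`, the
vanishing of the `ζ(5), ζ(3), ζ(2)` parts), `F_n = 6(u_nζ(4) − v_n)` is proved by the second-order recursion shared by
both sides (Lemma 3 for `F`; (3) for `u, v`, `ZetaFourRates.u_cast_cleared`) from the two initial values
`F_0 = 6ζ(4)` (`R_0 = 2/t³`) and `F_1 = 72ζ(4) − 78 = 6(u_1ζ(4) − v_1)` (the partial fractions (18) of `R_1`,
`R_one_eq`) — a genuinely shorter road to the same printed statement. Theorem 1 (7) then follows from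
`v_n/u_n = ζ(4) − F_n/(6u_n)`, the bound `|F_n| ≤ 72n + 42` (`ZetaFourAnalysis.abs_F_le`) and `u_n ≥ 12ⁿ`
(`ZetaFourRates.u_pos_ratio`); the form asymptotics by `ZetaFourRates.form_asymptotics_of_theorem1_limit`.

## Main statements

* `lemma3 (m) : (m+2)⁵F_{m+2} = b(m+1)F_{m+1} + c(m+1)F_m` [Zudilin 2003, §2 Lemma 3];
* `F_zero : F 0 = 6ζ(4)`, `F_one : F 1 = 72ζ(4) − 78`;
* `lemma5_holds : lemma5`, `theorem1_limit_holds : theorem1_limit`, `form_asymptotics_holds : form_asymptotics`,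
  `tendsto_convergents` (Theorem 2 unconditionally), `F_ne_zero`, `tendsto_log_abs_F_div` (`log|F_n|/n → 3 log|3−2√3|`).

HONEST FRAMING (cell zeta5-irr): this completes the formal proof of the ANALYTIC half of Zudilin's Theorem 1 for
`ζ(4)` (the limit (7) and the rates); the ARITHMETIC half (6) (`theorem1_inclusions`: `6D_nu_n ∈ ℤ`,
`6D_n⁵v_n ∈ ℤ`, Lemma 4) remains a named fact. Nothing here concerns `ζ(5)`; as printed (p0004), the forms
`6D_n⁵(u_nζ(4) − v_n)` do not tend to `0`, so no irrationality statement follows. No rung moves.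
-/

noncomputable section

open Finset Filter Topology
open scoped Nat
open Literature.NumberTheory.Transcendental (zetaValue)

namespace Literature.NumberTheory.Irrationality.Zudilin2003.ZetaFour

/-! ### The certificate numerator as a polynomial in `t`: derivative and growth -/

open Polynomial in
/-- `|p(t)| ≤ (Σ_i |p_i|)·t^{deg p}` for `t ≥ 1`. [folklore] -/
private theorem abs_eval_le (p : ℝ[X]) {t : ℝ} (ht : 1 ≤ t) :
    |p.eval t| ≤ (∑ i ∈ p.support, |p.coeff i|) * t ^ p.natDegree := by
  have ht0 : 0 ≤ t := by linarith
  rw [eval_eq_sum, sum_def]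
  calc |∑ i ∈ p.support, p.coeff i * t ^ i| ≤ ∑ i ∈ p.support, |p.coeff i * t ^ i| :=
        abs_sum_le_sum_abs _ _
    _ ≤ ∑ i ∈ p.support, |p.coeff i| * t ^ p.natDegree := by
        refine sum_le_sum fun i hi => ?_
        rw [abs_mul, abs_pow, abs_of_nonneg ht0]
        refine mul_le_mul_of_nonneg_left ?_ (abs_nonneg _)
        exact pow_le_pow_right₀ ht (le_natDegree_of_mem_supp i hi)
    _ = (∑ i ∈ p.support, |p.coeff i|) * t ^ p.natDegree := by rw [sum_mul]

open Polynomial in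
/-- The numerator `sNum(n, ·)` of (23) as a real polynomial in `t`. [cite: Zudilin2003WellPoised, §2 eq. (23)] -/
def sNumX (n : ℝ) : ℝ[X] := sNum (C n) X

open Polynomial in
/-- `sNumX n` evaluates to `sNum n`. [cite: Zudilin2003WellPoised, §2 eq. (23)] -/
theorem eval_sNumX (n t : ℝ) : (sNumX n).eval t = sNum n t := by
  simp only [sNumX, sNum, eval_add, eval_sub, eval_neg, eval_mul, eval_pow, eval_C, eval_X, eval_ofNat,
    eval_one]

open Polynomial in
/-- `deg_t sNum ≤ 8`. [cite: Zudilin2003WellPoised, §2 eq. (23)] -/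
theorem natDegree_sNumX_le (n : ℝ) : (sNumX n).natDegree ≤ 8 := by
  unfold sNumX sNum
  compute_degree!

open Polynomial in
/-- `sNum(n, ·)` is differentiable in `t`, with derivative the evaluation of the derived polynomial.
[cite: Zudilin2003WellPoised, §2 eq. (23)] -/
theorem hasDerivAt_sNum (n : ℕ) (t : ℝ) :
    HasDerivAt (fun t => sNum (n : ℝ) t) ((derivative (sNumX n)).eval t) t := by
  have h : (fun t => sNum (n : ℝ) t) = fun t => (sNumX n).eval t := funext fun t => (eval_sNumX n t).symm
  rw [h]
  exact Polynomial.hasDerivAt _ _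

open Polynomial in
/-- Polynomial growth of the certificate numerator: `|sNum(n,t)| ≤ K t⁸` for `t ≥ 1`.
[cite: Zudilin2003WellPoised, §2 eq. (23)] -/
theorem exists_sNum_bound (n : ℕ) : ∃ K : ℝ, 0 ≤ K ∧ ∀ t : ℝ, 1 ≤ t → |sNum (n : ℝ) t| ≤ K * t ^ 8 := by
  refine ⟨∑ i ∈ (sNumX n).support, |(sNumX n).coeff i|, sum_nonneg fun i _ => abs_nonneg _, fun t ht => ?_⟩
  rw [← eval_sNumX]
  refine (abs_eval_le (sNumX n) ht).trans ?_
  refine mul_le_mul_of_nonneg_left ?_ (sum_nonneg fun i _ => abs_nonneg _)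
  exact pow_le_pow_right₀ ht (natDegree_sNumX_le n)

open Polynomial in
/-- Polynomial growth of its `t`-derivative: `|∂_t sNum(n,t)| ≤ K' t⁷` for `t ≥ 1`.
[cite: Zudilin2003WellPoised, §2 eq. (23)] -/
theorem exists_sNumD_bound (n : ℕ) :
    ∃ K : ℝ, 0 ≤ K ∧ ∀ t : ℝ, 1 ≤ t → |(derivative (sNumX n)).eval t| ≤ K * t ^ 7 := by
  refine ⟨∑ i ∈ (derivative (sNumX n)).support, |(derivative (sNumX n)).coeff i|,
    sum_nonneg fun i _ => abs_nonneg _, fun t ht => ?_⟩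
  refine (abs_eval_le _ ht).trans ?_
  refine mul_le_mul_of_nonneg_left ?_ (sum_nonneg fun i _ => abs_nonneg _)
  refine pow_le_pow_right₀ ht ?_
  have h1 := natDegree_derivative_le (sNumX n)
  have h2 := natDegree_sNumX_le n
  omega

/-! ### `S_n = (−1)ⁿ sNum · H_n²` with `H_n = G_n/((t+2n−1)(t+2n))`, and its derivative -/

/-- `H_n(t) = G_n(t)/((t+2n−1)(t+2n))`. [cite: Zudilin2003WellPoised, §2 eq. (23) (S_n = s_nR_n)] -/
def Hblock (n : ℕ) (t : ℝ) : ℝ := Gblock n t / ((t + 2 * n - 1) * (t + 2 * n))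

/-- `H_n' = (G_n'·D − G_n·D')/D²`, `D = (t+2n−1)(t+2n)`, `D' = 2t+4n−1`. [cite: Zudilin2003WellPoised, §2 eq. (23)] -/
def Hd (n : ℕ) (t : ℝ) : ℝ :=
  (Gd n t * ((t + 2 * n - 1) * (t + 2 * n)) - Gblock n t * (2 * t + 4 * n - 1)) /
    ((t + 2 * n - 1) * (t + 2 * n)) ^ 2

/-- **`S_n = (−1)ⁿ sNum_n H_n²`** for `t > 0`, `n ≥ 1` (the factor `2t+n` of `R_n` cancels the one in `s_n`).
[cite: Zudilin2003WellPoised, §2 eq. (23)] -/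
theorem S_eq_H (n : ℕ) (hn : 1 ≤ n) {t : ℝ} (ht : 0 < t) :
    S n t = (-1) ^ n * sNum (n : ℝ) t * Hblock n t ^ 2 := by
  have hn' : (1 : ℝ) ≤ n := by exact_mod_cast hn
  have h1 : 2 * t + (n : ℝ) ≠ 0 := by positivity
  have h2 : t + 2 * (n : ℝ) - 1 ≠ 0 := by intro h; linarith
  have h3 : t + 2 * (n : ℝ) ≠ 0 := by positivity
  unfold S s Hblock
  rw [R_eq_G]
  field_simp

/-- `H_n` is differentiable at `t > 0` (`n ≥ 1`) with derivative `Hd`. [cite: Zudilin2003WellPoised, §2 eq. (23)] -/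
theorem hasDerivAt_Hblock (n : ℕ) (hn : 1 ≤ n) {t : ℝ} (ht : 0 < t) : HasDerivAt (Hblock n) (Hd n t) t := by
  have hn' : (1 : ℝ) ≤ n := by exact_mod_cast hn
  have h2 : t + 2 * (n : ℝ) - 1 ≠ 0 := by intro h; linarith
  have h3 : t + 2 * (n : ℝ) ≠ 0 := by positivity
  have ha : HasDerivAt (fun t : ℝ => t + 2 * n - 1) 1 t := ((hasDerivAt_id t).add_const _).sub_const _
  have hb : HasDerivAt (fun t : ℝ => t + 2 * n) 1 t := (hasDerivAt_id t).add_const _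
  have hD : HasDerivAt (fun t : ℝ => (t + 2 * n - 1) * (t + 2 * n)) (1 * (t + 2 * n) + (t + 2 * n - 1) * 1) t :=
    ha.mul hb
  have h := (hasDerivAt_Gblock n ht).div hD (mul_ne_zero h2 h3)
  refine h.congr_deriv ?_
  simp only [Hd]
  ring

/-- The derivative value of `S_n` (through the `H`-form). [cite: Zudilin2003WellPoised, §2 (proof of Lemma 3)] -/
def Sd (n : ℕ) (t : ℝ) : ℝ :=
  (-1) ^ n * ((Polynomial.derivative (sNumX n)).eval t * Hblock n t ^ 2 +
    sNum (n : ℝ) t * (2 * Hblock n t * Hd n t))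

/-- **`S_n` is differentiable at `t > 0` (`n ≥ 1`) with derivative `Sd`.** [cite: Zudilin2003WellPoised, §2 (proof of Lemma 3)] -/
theorem hasDerivAt_S (n : ℕ) (hn : 1 ≤ n) {t : ℝ} (ht : 0 < t) : HasDerivAt (S n) (Sd n t) t := by
  have h1 := ((hasDerivAt_sNum n t).mul ((hasDerivAt_Hblock n hn ht).pow 2)).const_mul ((-1 : ℝ) ^ n)
  have h2 : HasDerivAt (fun t => (-1) ^ n * (sNum (n : ℝ) t * Hblock n t ^ 2)) (Sd n t) t := by
    refine h1.congr_deriv ?_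
    simp only [Sd, Pi.pow_apply, Nat.cast_ofNat, Nat.add_one_sub_one, pow_one]
  refine h2.congr_of_eventuallyEq ?_
  filter_upwards [Ioi_mem_nhds ht] with x hx
  rw [S_eq_H n hn hx]
  ring

/-- `deriv S_n = Sd` at `t > 0`. [cite: Zudilin2003WellPoised, §2 (proof of Lemma 3)] -/
theorem deriv_S_eq (n : ℕ) (hn : 1 ≤ n) {t : ℝ} (ht : 0 < t) : deriv (S n) t = Sd n t :=
  (hasDerivAt_S n hn ht).deriv

/-- **`S_n'(1) = 0`** (`n ≥ 1`): the double zero of `R_n` at `t = 1`. [cite: Zudilin2003WellPoised, §2 (proof of Lemma 3, "S_n'(1) = 0")] -/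
theorem Sd_one (n : ℕ) (hn : 1 ≤ n) : Sd n 1 = 0 := by
  have hG : Gblock n 1 = 0 := by exact_mod_cast Gblock_natCast_eq_zero n 1 le_rfl hn
  simp [Sd, Hblock, hG]

/-! ### The bound `S_n'(t) = O(1/t)` -/

/-- `|H_n(t)| ≤ 1/t⁴` for `t ≥ n+1` (`n ≥ 1`). [cite: Zudilin2003WellPoised, §2 (proof of Lemma 3, "S_n'(t) = O(t⁻²)")] -/
theorem abs_Hblock_le (n : ℕ) (hn : 1 ≤ n) {t : ℝ} (ht : (n : ℝ) + 1 ≤ t) : |Hblock n t| ≤ 1 / t ^ 4 := by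
  have hn' : (1 : ℝ) ≤ n := by exact_mod_cast hn
  have ht0 : 0 < t := by linarith
  have hG := Gblock_le n ht
  have hGp := Gblock_pos n (by linarith : (n : ℝ) < t)
  have hD1 : t ≤ t + 2 * (n : ℝ) - 1 := by linarith
  have hD2 : t ≤ t + 2 * (n : ℝ) := by linarith
  have hDpos : 0 < (t + 2 * (n : ℝ) - 1) * (t + 2 * n) := mul_pos (by linarith) (by linarith)
  unfold Hblock
  rw [abs_div, abs_of_pos hGp, abs_of_pos hDpos]
  rw [div_le_div_iff₀ hDpos (pow_pos ht0 4), one_mul]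
  have ht2 : t ^ 2 ≤ (t + 2 * (n : ℝ) - 1) * (t + 2 * n) := by nlinarith
  calc Gblock n t * t ^ 4 ≤ (1 / t ^ 2) * t ^ 4 := mul_le_mul_of_nonneg_right hG (by positivity)
    _ = t ^ 2 := by field_simp
    _ ≤ _ := ht2

/-- `|H_n'(t)| ≤ (8n+7)/t⁵` for `t ≥ 4n+4` (`n ≥ 1`). [cite: Zudilin2003WellPoised, §2 (proof of Lemma 3, "S_n'(t) = O(t⁻²)")] -/
theorem abs_Hd_le (n : ℕ) (hn : 1 ≤ n) {t : ℝ} (ht : 4 * (n : ℝ) + 4 ≤ t) : |Hd n t| ≤ (8 * n + 7) / t ^ 5 := by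
  have hn' : (1 : ℝ) ≤ n := by exact_mod_cast hn
  have ht1 : (n : ℝ) + 1 ≤ t := by linarith
  have ht0 : 0 < t := by linarith
  have htn : 0 < t - n := by linarith
  have hG := Gblock_le n ht1
  have hGp := Gblock_pos n (by linarith : (n : ℝ) < t)
  have hGd := abs_Gd_le n ht1
  have hDge : t ^ 2 ≤ (t + 2 * (n : ℝ) - 1) * (t + 2 * n) := by nlinarith
  have hDpos : 0 < (t + 2 * (n : ℝ) - 1) * (t + 2 * n) := lt_of_lt_of_le (by positivity) hDge
  have hD' : |2 * t + 4 * (n : ℝ) - 1| ≤ 3 * t := by rw [abs_of_pos (by linarith)]; linarith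
  unfold Hd
  generalize (t + 2 * (n : ℝ) - 1) * (t + 2 * n) = D at hDge hDpos ⊢
  rw [abs_div, abs_pow, abs_of_pos hDpos]
  -- numerator bound
  have hnum : |Gd n t * D - Gblock n t * (2 * t + 4 * n - 1)| ≤
      Gblock n t * ((4 * n + 2) / (t - n)) * D + Gblock n t * (3 * t) := by
    calc |Gd n t * D - Gblock n t * (2 * t + 4 * n - 1)|
        ≤ |Gd n t * D| + |Gblock n t * (2 * t + 4 * n - 1)| := abs_sub _ _
      _ ≤ Gblock n t * ((4 * n + 2) / (t - n)) * D + Gblock n t * (3 * t) := by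
          rw [abs_mul, abs_mul, abs_of_pos hDpos, abs_of_pos hGp]
          exact add_le_add (mul_le_mul_of_nonneg_right hGd hDpos.le)
            (mul_le_mul_of_nonneg_left hD' hGp.le)
  rw [div_le_div_iff₀ (by positivity) (by positivity)]
  -- `(G(4n+2)/(t−n)·D + 3tG)·t⁵ ≤ (8n+7)·D²`, using `G ≤ 1/t²`, `D ≥ t²`, `t − n ≥ t/2`
  have h1 : Gblock n t * ((4 * n + 2) / (t - n)) * D * t ^ 5 ≤ (8 * n + 4) * D ^ 2 := by
    have htn2 : t / 2 ≤ t - n := by linarith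
    have hq : (4 * (n : ℝ) + 2) / (t - n) ≤ (8 * n + 4) / t := by
      rw [div_le_div_iff₀ htn (by positivity)]; nlinarith
    calc Gblock n t * ((4 * n + 2) / (t - n)) * D * t ^ 5
        ≤ (1 / t ^ 2) * ((8 * n + 4) / t) * D * t ^ 5 := by
          have := mul_le_mul hG hq (by positivity) (by positivity)
          exact mul_le_mul_of_nonneg_right (mul_le_mul_of_nonneg_right this hDpos.le) (by positivity)
      _ = (8 * n + 4) * (D * t ^ 2) := by field_simp
      _ ≤ (8 * n + 4) * (D * D) := by
          refine mul_le_mul_of_nonneg_left (mul_le_mul_of_nonneg_left hDge hDpos.le) (by positivity)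
      _ = (8 * n + 4) * D ^ 2 := by ring
  have h2 : Gblock n t * (3 * t) * t ^ 5 ≤ 3 * D ^ 2 := by
    calc Gblock n t * (3 * t) * t ^ 5 ≤ (1 / t ^ 2) * (3 * t) * t ^ 5 := by
          have := mul_le_mul_of_nonneg_right hG (by positivity : (0 : ℝ) ≤ 3 * t)
          nlinarith [pow_pos ht0 5]
      _ = 3 * (t ^ 2 * t ^ 2) := by field_simp
      _ ≤ 3 * (D * D) := by
          refine mul_le_mul_of_nonneg_left ?_ (by norm_num)
          exact mul_le_mul hDge hDge (by positivity) hDpos.le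
      _ = 3 * D ^ 2 := by ring
  calc |Gd n t * D - Gblock n t * (2 * t + 4 * n - 1)| * t ^ 5
      ≤ (Gblock n t * ((4 * n + 2) / (t - n)) * D + Gblock n t * (3 * t)) * t ^ 5 :=
        mul_le_mul_of_nonneg_right hnum (by positivity)
    _ = Gblock n t * ((4 * n + 2) / (t - n)) * D * t ^ 5 + Gblock n t * (3 * t) * t ^ 5 := by ring
    _ ≤ (8 * n + 4) * D ^ 2 + 3 * D ^ 2 := add_le_add h1 h2
    _ = (8 * n + 7) * D ^ 2 := by ring

/-- **`S_n'(t) → 0`** along the integers (indeed `S_n'(t) = O(1/t)`; the printed `S_n'(t) = O(t⁻²)`).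
[cite: Zudilin2003WellPoised, §2 (proof of Lemma 3, "S_n'(t) = O(t⁻²)")] -/
theorem tendsto_Sd (n : ℕ) (hn : 1 ≤ n) : Tendsto (fun N : ℕ => Sd n ((N : ℝ) + 1)) atTop (𝓝 0) := by
  obtain ⟨K, hK0, hK⟩ := exists_sNum_bound n
  obtain ⟨K', hK0', hK'⟩ := exists_sNumD_bound n
  have hn' : (1 : ℝ) ≤ n := by exact_mod_cast hn
  -- `|Sd n t| ≤ (K' + 2K(8n+7))/t` for `t ≥ 4n+4`
  have hbound : ∀ t : ℝ, 4 * (n : ℝ) + 4 ≤ t → |Sd n t| ≤ (K' + 2 * K * (8 * n + 7)) / t := by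
    intro t ht
    have ht0 : 0 < t := by linarith
    have ht1 : 1 ≤ t := by linarith
    have htn : (n : ℝ) + 1 ≤ t := by linarith
    have hH := abs_Hblock_le n hn htn
    have hHd := abs_Hd_le n hn ht
    have hs := hK t ht1
    have hs' := hK' t ht1
    unfold Sd
    rw [abs_mul, abs_pow, abs_neg, abs_one, one_pow, one_mul]
    have hA : |(Polynomial.derivative (sNumX n)).eval t * Hblock n t ^ 2| ≤ K' / t := by
      rw [abs_mul, abs_pow]
      have hH2 : |Hblock n t| ^ 2 ≤ (1 / t ^ 4) ^ 2 := pow_le_pow_left₀ (abs_nonneg _) hH 2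
      calc |(Polynomial.derivative (sNumX n)).eval t| * |Hblock n t| ^ 2 ≤ (K' * t ^ 7) * (1 / t ^ 4) ^ 2 :=
            mul_le_mul hs' hH2 (by positivity) (by positivity)
        _ = K' / t := by field_simp
    have hB : |sNum (n : ℝ) t * (2 * Hblock n t * Hd n t)| ≤ 2 * K * (8 * n + 7) / t := by
      rw [abs_mul, abs_mul, abs_mul, abs_two]
      calc |sNum (n : ℝ) t| * (2 * |Hblock n t| * |Hd n t|)
          ≤ (K * t ^ 8) * (2 * (1 / t ^ 4) * ((8 * n + 7) / t ^ 5)) := by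
            refine mul_le_mul hs ?_ (by positivity) (by positivity)
            exact mul_le_mul (mul_le_mul_of_nonneg_left hH (by norm_num)) hHd (abs_nonneg _) (by positivity)
        _ = 2 * K * (8 * n + 7) / t := by field_simp
    calc |(Polynomial.derivative (sNumX n)).eval t * Hblock n t ^ 2 + sNum (n : ℝ) t * (2 * Hblock n t * Hd n t)|
        ≤ K' / t + 2 * K * (8 * n + 7) / t := (abs_add_le _ _).trans (add_le_add hA hB)
      _ = (K' + 2 * K * (8 * n + 7)) / t := by ring
  -- squeeze
  have hlim : Tendsto (fun N : ℕ => (K' + 2 * K * (8 * n + 7)) / ((N : ℝ) + 1)) atTop (𝓝 0) :=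
    tendsto_const_nhds.div_atTop (tendsto_natCast_atTop_atTop.atTop_add tendsto_const_nhds)
  refine squeeze_zero_norm' ?_ hlim
  filter_upwards [eventually_ge_atTop (4 * n + 4)] with N hN
  rw [Real.norm_eq_abs]
  have h' : (4 * n + 4 : ℝ) ≤ N := by exact_mod_cast hN
  exact hbound _ (by linarith)

/-! ### Lemma 3: `F_n` satisfies the difference equation (3) -/

/-- The differentiated certificate identity (24): for `t > 0`,
`(m+2)⁵R'_{m+2}(t) − b(m+1)R'_{m+1}(t) − c(m+1)R'_m(t) = S'_{m+1}(t+1) − S'_{m+1}(t)`.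
[cite: Zudilin2003WellPoised, §2 (proof of Lemma 3)] -/
theorem deriv_identity (m : ℕ) {t : ℝ} (ht : 0 < t) :
    ((m : ℝ) + 2) ^ 5 * Rd (m + 2) t - b ((m : ℝ) + 1) * Rd (m + 1) t - c ((m : ℝ) + 1) * Rd m t =
      Sd (m + 1) (t + 1) - Sd (m + 1) t := by
  have hm1 : 1 ≤ m + 1 := by omega
  have hL : HasDerivAt (fun t => ((m : ℝ) + 2) ^ 5 * R (m + 2) t - b ((m : ℝ) + 1) * R (m + 1) t -
      c ((m : ℝ) + 1) * R m t)
      (((m : ℝ) + 2) ^ 5 * Rd (m + 2) t - b ((m : ℝ) + 1) * Rd (m + 1) t - c ((m : ℝ) + 1) * Rd m t) t :=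
    (((hasDerivAt_R (m + 2) ht).const_mul _).sub ((hasDerivAt_R (m + 1) ht).const_mul _)).sub
      ((hasDerivAt_R m ht).const_mul _)
  have hR : HasDerivAt (fun t => S (m + 1) (t + 1) - S (m + 1) t) (Sd (m + 1) (t + 1) - Sd (m + 1) t) t := by
    have h1 : HasDerivAt (fun t => S (m + 1) (t + 1)) (Sd (m + 1) (t + 1)) t :=
      (hasDerivAt_S (m + 1) hm1 (by linarith : 0 < t + 1)).comp_add_const t 1
    exact h1.sub (hasDerivAt_S (m + 1) hm1 ht)
  have heq : (fun t => ((m : ℝ) + 2) ^ 5 * R (m + 2) t - b ((m : ℝ) + 1) * R (m + 1) t -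
      c ((m : ℝ) + 1) * R m t) =ᶠ[𝓝 t] fun t => S (m + 1) (t + 1) - S (m + 1) t := by
    filter_upwards [Ioi_mem_nhds ht] with x hx
    have h := lemma2 (m + 1) hm1 x hx
    rw [show m + 1 + 1 = m + 2 from rfl, Nat.add_sub_cancel] at h
    rw [← h]
    push_cast
    ring
  exact hL.unique (hR.congr_of_eventuallyEq heq)

/-- `Σ_{t≥1} R_j'(t) = −F_j` (as a `HasSum` of the explicit derivative `Rd`). [cite: Zudilin2003WellPoised, §2 eq. (11)] -/
theorem hasSum_Rd (j : ℕ) : HasSum (fun k : ℕ => Rd j ((k : ℝ) + 1)) (-F j) := by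
  have h := (hasSum_F j).neg
  refine h.congr_fun fun k => ?_
  rw [neg_neg, deriv_R_eq j (by positivity : (0 : ℝ) < k + 1)]

/-- **Lemma 3** (Zudilin 2003): the series `F_n` satisfies the difference equation (3), i.e.
`(m+2)⁵F_{m+2} = b(m+1)F_{m+1} + 3(m+1)³(3m+2)(3m+4)F_m` — by summing the `t`-derivative of (24) over
`t = 1, 2, …`, the right side telescoping to `−S_n'(1) = 0`. [cite: Zudilin2003WellPoised, §2 Lemma 3] -/
theorem lemma3 (m : ℕ) :
    ((m : ℝ) + 2) ^ 5 * F (m + 2) = b ((m : ℝ) + 1) * F (m + 1) + c ((m : ℝ) + 1) * F m := by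
  have hm1 : 1 ≤ m + 1 := by omega
  have hcomb : HasSum (fun k : ℕ => ((m : ℝ) + 2) ^ 5 * Rd (m + 2) ((k : ℝ) + 1) -
      b ((m : ℝ) + 1) * Rd (m + 1) ((k : ℝ) + 1) - c ((m : ℝ) + 1) * Rd m ((k : ℝ) + 1))
      (((m : ℝ) + 2) ^ 5 * -F (m + 2) - b ((m : ℝ) + 1) * -F (m + 1) - c ((m : ℝ) + 1) * -F m) :=
    (((hasSum_Rd (m + 2)).mul_left _).sub ((hasSum_Rd (m + 1)).mul_left _)).sub ((hasSum_Rd m).mul_left _)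
  have hcomb' : HasSum (fun k : ℕ => Sd (m + 1) ((k : ℝ) + 1 + 1) - Sd (m + 1) ((k : ℝ) + 1))
      (((m : ℝ) + 2) ^ 5 * -F (m + 2) - b ((m : ℝ) + 1) * -F (m + 1) - c ((m : ℝ) + 1) * -F m) := by
    refine hcomb.congr_fun fun k => ?_
    exact (deriv_identity m (by positivity : (0 : ℝ) < k + 1)).symm
  -- partial sums telescope to `S'_{m+1}(N+1) − S'_{m+1}(1) = S'_{m+1}(N+1) → 0`
  have hps : ∀ N : ℕ, ∑ k ∈ range N, (Sd (m + 1) ((k : ℝ) + 1 + 1) - Sd (m + 1) ((k : ℝ) + 1)) =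
      Sd (m + 1) ((N : ℝ) + 1) := by
    intro N
    have h := Finset.sum_range_sub (fun k : ℕ => Sd (m + 1) ((k : ℝ) + 1)) N
    simp only [Nat.cast_add, Nat.cast_one, Nat.cast_zero, zero_add, Sd_one _ hm1, sub_zero] at h
    exact h
  have h1 := hcomb'.tendsto_sum_nat
  simp_rw [hps] at h1
  have h0 := tendsto_nhds_unique h1 (tendsto_Sd (m + 1) hm1)
  linarith

/-! ### Initial values: `F_0 = 6ζ(4)`, `F_1 = 72ζ(4) − 78` -/

/-- `R_0(t) = 2/t³`. [cite: Zudilin2003WellPoised, §2 eq. (10)] -/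
theorem R_zero_eq {t : ℝ} (ht : t ≠ 0) : R 0 t = 2 / t ^ 3 := by
  simp only [R, pow_zero, Nat.cast_zero, add_zero, prod_range_zero, prod_range_succ, one_mul, mul_one, zero_add]
  field_simp

/-- `R_1(t) = −13/t² + 12/t³ − 4/t⁴ + 13/(t+1)² + 12/(t+1)³ + 4/(t+1)⁴` (its partial fractions, (18) for `n = 1`).
[cite: Zudilin2003WellPoised, §2 eq. (18)] -/
theorem R_one_eq {t : ℝ} (ht : 0 < t) :
    R 1 t = -13 / t ^ 2 + 12 / t ^ 3 - 4 / t ^ 4 + 13 / (t + 1) ^ 2 + 12 / (t + 1) ^ 3 + 4 / (t + 1) ^ 4 := by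
  have h1 : t + 1 ≠ 0 := by positivity
  have h0 : t ≠ 0 := ht.ne'
  simp only [R, prod_range_succ, prod_range_zero, one_mul, Nat.cast_zero, Nat.cast_one, pow_one]
  field_simp
  ring

/-- `d/dx (x^{k+1})⁻¹ = −(k+1)/x^{k+2}`. [folklore] -/
private theorem hasDerivAt_inv_pow (k : ℕ) {t : ℝ} (ht : t ≠ 0) :
    HasDerivAt (fun x : ℝ => (x ^ (k + 1))⁻¹) (-((k : ℝ) + 1) / t ^ (k + 2)) t := by
  have h := (hasDerivAt_pow (k + 1) t).inv (pow_ne_zero _ ht)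
  refine h.congr_deriv ?_
  rw [Nat.add_sub_cancel]
  push_cast
  field_simp
  ring

/-- `d/dx ((x+1)^{k+1})⁻¹ = −(k+1)/(x+1)^{k+2}`. [folklore] -/
private theorem hasDerivAt_inv_pow_shift (k : ℕ) {t : ℝ} (ht : t + 1 ≠ 0) :
    HasDerivAt (fun x : ℝ => ((x + 1) ^ (k + 1))⁻¹) (-((k : ℝ) + 1) / (t + 1) ^ (k + 2)) t := by
  have h := (((hasDerivAt_id t).add_const (1 : ℝ)).pow (k + 1)).inv (pow_ne_zero _ ht)
  refine h.congr_deriv ?_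
  simp only [Pi.pow_apply, id, Nat.add_sub_cancel, Nat.cast_add, Nat.cast_one, mul_one]
  field_simp
  ring

/-- `R_0'(t) = −6/t⁴` for `t > 0`. [cite: Zudilin2003WellPoised, §2 eqs. (10)–(11)] -/
theorem deriv_R_zero {t : ℝ} (ht : 0 < t) : deriv (R 0) t = -6 / t ^ 4 := by
  have h : HasDerivAt (fun x : ℝ => 2 * (x ^ (2 + 1))⁻¹) (2 * (-((2 : ℕ) + 1 : ℝ) / t ^ (2 + 2))) t :=
    (hasDerivAt_inv_pow 2 ht.ne').const_mul 2
  have h' : HasDerivAt (R 0) (2 * (-((2 : ℕ) + 1 : ℝ) / t ^ (2 + 2))) t := by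
    refine h.congr_of_eventuallyEq ?_
    filter_upwards [Ioi_mem_nhds ht] with x hx
    rw [R_zero_eq (ne_of_gt hx)]
    simp [div_eq_mul_inv]
  rw [h'.deriv]
  push_cast
  ring

/-- `R_1'(t) = 26/t³ − 36/t⁴ + 16/t⁵ − 26/(t+1)³ − 36/(t+1)⁴ − 16/(t+1)⁵` for `t > 0`.
[cite: Zudilin2003WellPoised, §2 eqs. (18)–(21) (n = 1)] -/
theorem deriv_R_one {t : ℝ} (ht : 0 < t) :
    deriv (R 1) t = 26 / t ^ 3 - 36 / t ^ 4 + 16 / t ^ 5 - 26 / (t + 1) ^ 3 - 36 / (t + 1) ^ 4 -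
      16 / (t + 1) ^ 5 := by
  have h0 : t ≠ 0 := ht.ne'
  have h1 : t + 1 ≠ 0 := by positivity
  have h := (((((hasDerivAt_inv_pow 1 h0).const_mul (-13)).add ((hasDerivAt_inv_pow 2 h0).const_mul 12)).sub
    ((hasDerivAt_inv_pow 3 h0).const_mul 4)).add
    ((((hasDerivAt_inv_pow_shift 1 h1).const_mul 13).add ((hasDerivAt_inv_pow_shift 2 h1).const_mul 12)).add
      ((hasDerivAt_inv_pow_shift 3 h1).const_mul 4)))
  have h' : HasDerivAt (R 1) _ t := h.congr_of_eventuallyEq (by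
    filter_upwards [Ioi_mem_nhds ht] with x hx
    rw [R_one_eq hx]
    simp only [Pi.add_apply, Pi.sub_apply, div_eq_mul_inv]
    ring)
  rw [h'.deriv]
  push_cast
  field_simp
  ring

/-- `Σ_{k≥0} (k+1)^{-s} = ζ(s)` (`s ≥ 2`). [folklore] -/
private theorem hasSum_inv_succ_pow {s : ℕ} (hs : 2 ≤ s) :
    HasSum (fun k : ℕ => 1 / ((k : ℝ) + 1) ^ s) (zetaValue s) := by
  have hsum : Summable (fun n : ℕ => 1 / (n : ℝ) ^ s) := Real.summable_one_div_nat_pow.mpr (by omega)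
  have h := (hasSum_nat_add_iff' 1).mpr hsum.hasSum
  have hs0 : s ≠ 0 := by omega
  simp only [sum_range_one, Nat.cast_zero, zero_pow hs0, div_zero, sub_zero] at h
  rw [zetaValue]
  refine h.congr_fun fun k => ?_
  simp only [Nat.cast_add, Nat.cast_one]

/-- `Σ_{k≥0} (k+2)^{-s} = ζ(s) − 1` (`s ≥ 2`). [folklore] -/
private theorem hasSum_inv_add_two_pow {s : ℕ} (hs : 2 ≤ s) :
    HasSum (fun k : ℕ => 1 / ((k : ℝ) + 2) ^ s) (zetaValue s - 1) := by
  have h := (hasSum_nat_add_iff' 1).mpr (hasSum_inv_succ_pow hs)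
  simp only [sum_range_one, Nat.cast_zero, zero_add, one_pow, div_one] at h
  refine h.congr_fun fun k => ?_
  simp only [Nat.cast_add, Nat.cast_one]
  ring

/-- **`F_0 = 6ζ(4)`** (`u₀ = 1`, `v₀ = 0`). [cite: Zudilin2003WellPoised, §2 Lemma 5 with (5)] -/
theorem F_zero : F 0 = 6 * zetaValue 4 := by
  have h : HasSum (fun k : ℕ => -deriv (R 0) ((k : ℝ) + 1)) (6 * zetaValue 4) := by
    have h4 := (hasSum_inv_succ_pow (by norm_num : 2 ≤ 4)).mul_left 6
    refine h4.congr_fun fun k => ?_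
    rw [deriv_R_zero (by positivity)]
    ring
  exact (hasSum_F 0).unique h

/-- **`F_1 = 72ζ(4) − 78`** (`u₁ = 12`, `v₁ = 13`: `F_1 = 6(12ζ(4) − 13)`). [cite: Zudilin2003WellPoised, §2 Lemma 5 with (5)] -/
theorem F_one : F 1 = 72 * zetaValue 4 - 78 := by
  have h3 := hasSum_inv_succ_pow (by norm_num : 2 ≤ 3)
  have h4 := hasSum_inv_succ_pow (by norm_num : 2 ≤ 4)
  have h5 := hasSum_inv_succ_pow (by norm_num : 2 ≤ 5)
  have h3' := hasSum_inv_add_two_pow (by norm_num : 2 ≤ 3)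
  have h4' := hasSum_inv_add_two_pow (by norm_num : 2 ≤ 4)
  have h5' := hasSum_inv_add_two_pow (by norm_num : 2 ≤ 5)
  have h := ((((h3.mul_left 26).sub (h4.mul_left 36)).add (h5.mul_left 16)).sub
    (((h3'.mul_left 26).add (h4'.mul_left 36)).add (h5'.mul_left 16))).neg
  have h' : HasSum (fun k : ℕ => -deriv (R 1) ((k : ℝ) + 1)) _ := h.congr_fun fun k => by
    rw [deriv_R_one (by positivity), show (k : ℝ) + 1 + 1 = k + 2 by ring]
    ring
  rw [(hasSum_F 1).unique h']
  ring

/-! ### Lemma 5, Theorem 1 (7) and the form asymptotics -/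

/-- `u₀ = 1`, `u₁ = 12`, `v₀ = 0`, `v₁ = 13` (5), over `ℝ`. [cite: Zudilin2003WellPoised, §2 eq. (5)] -/
theorem initial_values : (u 0 : ℝ) = 1 ∧ (u 1 : ℝ) = 12 ∧ (v 0 : ℝ) = 0 ∧ (v 1 : ℝ) = 13 := by
  refine ⟨?_, ?_, ?_, ?_⟩ <;> norm_num [u, v, seq]

/-- **Lemma 5** (Zudilin 2003), discharged: `F_n = 6(u_nζ(4) − v_n)` for all `n` — both sides solve (3)
(Lemma 3 and (3) for `u, v`) with the same initial data `F_0 = 6ζ(4)`, `F_1 = 6(12ζ(4) − 13)`.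
[cite: Zudilin2003WellPoised, §2 Lemma 5] -/
theorem lemma5_holds : lemma5 := by
  intro n
  induction n using Nat.twoStepInduction with
  | zero => rw [F_zero, initial_values.1, initial_values.2.2.1]; ring
  | one => rw [F_one, initial_values.2.1, initial_values.2.2.2]; ring
  | more m h0 h1 =>
    have hm : ((m : ℝ) + 2) ^ 5 ≠ 0 := by positivity
    have hF := lemma3 m
    have hu := u_cast_cleared m
    have hv := v_cast_cleared m
    apply mul_left_cancel₀ hm
    rw [hF, h0, h1]
    linear_combination (-6 * zetaValue 4) * hu + 6 * hv

/-- `u_n ≥ 12ⁿ`. [cite: Zudilin2003WellPoised, §2 eqs. (3)–(5)] -/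
theorem pow_le_u (n : ℕ) : (12 : ℝ) ^ n ≤ (u n : ℝ) := by
  induction n with
  | zero => simp [initial_values.1]
  | succ k ih =>
    have h := (u_pos_ratio k).2
    calc (12 : ℝ) ^ (k + 1) = 12 * 12 ^ k := by ring
      _ ≤ 12 * (u k : ℝ) := by linarith
      _ ≤ _ := h

/-- `v_n/u_n = ζ(4) − F_n/(6u_n)`. [cite: Zudilin2003WellPoised, §2 Lemma 5] -/
theorem ratio_eq (n : ℕ) : ((v n / u n : ℚ) : ℝ) = zetaValue 4 - F n / (6 * (u n : ℝ)) := by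
  have hu := (u_pos_ratio n).1
  push_cast
  rw [lemma5_holds n]
  field_simp
  ring

/-- **Theorem 1, limit (7)** (Zudilin 2003), discharged: `v_n/u_n → ζ(4)` — from Lemma 5,
`|F_n| ≤ 72n + 42` and `u_n ≥ 12ⁿ`. [cite: Zudilin2003WellPoised, Theorem 1 (7)] -/
theorem theorem1_limit_holds : theorem1_limit := by
  unfold theorem1_limit
  simp_rw [ratio_eq]
  rw [show 𝓝 (zetaValue 4) = 𝓝 (zetaValue 4 - 0) by rw [sub_zero]]
  refine tendsto_const_nhds.sub ?_
  -- `|F_n/(6u_n)| ≤ (12n+7)/12ⁿ → 0`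
  have hlim : Tendsto (fun n : ℕ => 12 * ((n : ℝ) ^ 1 / 12 ^ n) + 7 * (1 / 12) ^ n) atTop (𝓝 0) := by
    have h1 := tendsto_pow_const_div_const_pow_of_one_lt 1 (by norm_num : (1 : ℝ) < 12)
    have h2 := tendsto_pow_atTop_nhds_zero_of_lt_one (by norm_num : (0 : ℝ) ≤ 1 / 12)
      (by norm_num : (1 : ℝ) / 12 < 1)
    have := (h1.const_mul 12).add (h2.const_mul 7)
    simpa using this
  refine squeeze_zero_norm (fun n => ?_) hlim
  have hu := (u_pos_ratio n).1
  have hF := abs_F_le n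
  have hp := pow_le_u n
  rw [Real.norm_eq_abs, abs_div, abs_of_pos (by positivity : (0 : ℝ) < 6 * u n), pow_one, one_div_pow,
    div_le_iff₀ (by positivity)]
  have h12 : (0 : ℝ) < 12 ^ n := by positivity
  calc |F n| ≤ 72 * n + 42 := hF
    _ = (12 * (n / 12 ^ n) + 7 * (1 / 12 ^ n)) * (6 * 12 ^ n) := by field_simp; ring
    _ ≤ (12 * (n / 12 ^ n) + 7 * (1 / 12 ^ n)) * (6 * (u n : ℝ)) := by
        refine mul_le_mul_of_nonneg_left (by linarith) (by positivity)

/-- **The form asymptotics** after Theorem 1, discharged: `lim log|u_nζ(4) − v_n|/n = 3 log|3 − 2√3|`.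
[cite: Zudilin2003WellPoised, §2 (display after Theorem 1)] -/
theorem form_asymptotics_holds : form_asymptotics := form_asymptotics_of_theorem1_limit theorem1_limit_holds

/-- **Theorem 2** (Zudilin 2003), unconditional: the convergents `P_n/Q_n` of the continued fraction
`13/|b(0)| + 1⁷·2·3·4/|b(1)| + ⋯` tend to `ζ(4)`. [cite: Zudilin2003WellPoised, Theorem 2] -/
theorem tendsto_convergents : Tendsto (fun n : ℕ => ((P n / Q n : ℚ) : ℝ)) atTop (𝓝 (zetaValue 4)) :=
  theorem2_of_theorem1 theorem1_limit_holds

/-- The linear forms `u_nζ(4) − v_n = F_n/6` are all nonzero (the limit `L` of `v_n/u_n` produced by the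
Casoratian argument of `ZetaFourRates.lean` has `u_nL − v_n ≠ 0`, and `L = ζ(4)` by Theorem 1 (7)).
[cite: Zudilin2003WellPoised, §2 (display after Theorem 1: `log|u_nζ(4) − v_n|/n → 3 log|3 − 2√3|`)] -/
theorem F_ne_zero (n : ℕ) : F n ≠ 0 := by
  obtain ⟨L, hL, hne, -⟩ := exists_limit_rates
  have hlim : Tendsto (fun n : ℕ => (v n : ℝ) / u n) atTop (𝓝 (zetaValue 4)) := by
    have h := theorem1_limit_holds
    unfold theorem1_limit at h
    refine h.congr' (Eventually.of_forall fun n => ?_)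
    push_cast
    rfl
  have hLz : L = zetaValue 4 := tendsto_nhds_unique hL hlim
  rw [lemma5_holds n]
  have := hne n
  rw [hLz] at this
  exact mul_ne_zero (by norm_num) this

/-- **`|F_n| → 0` geometrically**: `log|F_n|/n → 3 log|3 − 2√3| = −2.30295525…` (Section 4 of the source proves
`|F_n| → 0` through the integral (34); here it follows from `F_n = 6(u_nζ(4) − v_n)` and the form asymptotics).
[cite: Zudilin2003WellPoised, §2 (display after Theorem 1) and §4 Lemma 7] -/
theorem tendsto_log_abs_F_div :
    Tendsto (fun n : ℕ => Real.log |F n| / n) atTop (𝓝 (3 * Real.log |3 - 2 * Real.sqrt 3|)) := by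
  have h := form_asymptotics_holds
  unfold form_asymptotics at h
  have h6 : Tendsto (fun n : ℕ => Real.log 6 / n) atTop (𝓝 0) :=
    tendsto_const_nhds.div_atTop tendsto_natCast_atTop_atTop
  have hsum := h.add h6
  rw [add_zero] at hsum
  refine hsum.congr' ?_
  filter_upwards [eventually_ge_atTop 1] with n hn
  have hne : (u n : ℝ) * zetaValue 4 - v n ≠ 0 := by
    have := F_ne_zero n
    rw [lemma5_holds n] at this
    exact fun h0 => this (by rw [h0, mul_zero])
  rw [lemma5_holds n, abs_mul, Real.log_mul (by norm_num) (abs_ne_zero.mpr hne), abs_of_pos (by norm_num : (0:ℝ) < 6)]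
  ring

end Literature.NumberTheory.Irrationality.Zudilin2003.ZetaFour

end
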